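import Summits.BirchSwinnertonDyer.Rank1Residual.JET.CarrierReadingRecordsKitThree
import HarnessLib

/-!
# BSD rank-≤1 residual cell, lane class X4 (ADDITIVE at `3`, `ρ̄_{E,3}` onto), BOTH ranks, Tamagawa-OBSTRUCTED with ONE carrier prime `q ≠ 3`:
# `BSD(E,3)` PER CELL through the JET lane's R-IDX kit doors `JET.bsdp_of_jetRowA3F_tam_min` / `_tamX_min` (ANY reduction at `3`, `3`-adic
# tower by ONE Frobenius witness mod `9`; READING binder K1) on a two-engine HEEGNER-INDEX line in a DEEP field — records 02 (x11c GEN 36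
# «J1-REMAINDER / KOLY-R»)

HONEST FRAMING (cell `b2b-bsdres-*`, verbatim): prove what is provable now; shrink each hard class to its core with data; no claim beyond
stated classes; COMBINATION classes deleted from PUBLISHED theorems only, CONSTRUCTION-shaped remainder typed; this is not "finishing BSD".
X4 / X11b (and X11 ∧ r = 1 ∧ p = 3) stay CONSTRUCTION-SHAPED; everything here is PER CELL; no lane verdict is changed; NO named fact is
introduced (debt 0) and NO definition; nothing is booked by this file (bookings are referee A's, pub-bsdpct); Cremona's numbers (`r_an`,
`#Ш_an`, models, generators, `∏ c_ℓ`, torsion, optimality / Manin codes, the galrep datum) and the Kurihara lane's per-prime tables are INPUTS.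

Unit `b2b-bsdres-x11c`, GEN 36 (prover-b2b-bsdres-x11c-g36-0), move «J1-REMAINDER / KOLY-R». POPULATION (`HOME/b2b-bsdres-x11c/gen36/pop/`:
`census36.py` over referee A's ROUND 983 state of record × the Kurihara lane's sweep records × Cremona, then `build_pop36.py`): EVERY live
residue cell on the Kolyvagin / Jetchev road classes (X4, X7, X8, X11a, X11b), BOTH ranks, odd `p`, whose shape is KOLY (`ρ̄_{E,p}` onto,
`p ∤ #E(ℚ)_tors·∏c·#Ш_an`: 30 cells) or J1 (onto, `p ∤ #E(ℚ)_tors·#Ш_an`, exactly ONE prime `q ∣ N` with `p ∣ c_q`: 171 cells; the two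
J1 cells whose carrier is an ADDITIVE `p` have no door and are excluded) — 199 cells on 191 classes (188 of them with this cell as their ONLY
open cell): 82 rank-one `(3, X11b)`, 59 `(5, X4)` + 2 `(7, X4)` (rank one 19 / rank zero 42), 26 `(3, X4)` J1 (1 / 25), 20 `(3, X4)` KOLY
(6 / 14), 10 KOLY at `p ≥ 5`. The lane never certified them: at rank one its Heegner fields (`|D| ≤ 1511`) read `ord_p [E(K):ℤy_K] = w + 1`
or found no admissible field; at rank zero (additive `p`) no Heegner-index line was ever run. THIS UNIT ran the cell's engines VERBATIM in
DEEPER fields: engine 1 = gen 3 `engine1_cha1b/main.py` = x9-g7 `jobD1b.py` (cypari2, sha256 `69e29ec7…`; rank-one mode: Cremona's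
generator, `hy = L'(E,1)·L(E^D,1)·√|D|/(4·Area)`, `m = √(4·hy/ĥ(P))`; rank-zero mode: the rank-one twist `F = E^D`, a point `x ∈ F(ℚ)` by
`ellrank`, saturated, `hy = L(E,1)·L'(F,1)·√|D|/(4·Area)`, `m = √(4·hy/ĥ(x))` — Miller 2011 Thm. 4.1 / Cor. 4.8; `NDISC 16`, `DBOUND 6000`);
engine 2 = gen 3 `run_cert.py` (`1b54bb20…`) + `e2lib.py` + `tate_stdlib.py` (stdlib re-implementation: `m`, `ord_p m` must be EQUAL,
discrete checks); twist values = additive-p1 `twistvals/main.py` (`e501b988…`). Kit jobs: see HOME/b2b-bsdres-x11c/gen36/harvest/JOBS-gen36.txt. Evidence `HOME/b2b-bsdres-x11c/gen36/`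
(POP36.md, ROWS36-TABLE.md, harvest outputs with inputs.sha256, SHA256SUMS); REPORT.md §45.

THE ROAD (cell `bsd-jet`'s R-IDX grammar, the doors referee A priced at pub-bsdpct ROUNDS 409 / 516 / 600 and booked this unit's
JDEEP rows on at ROUND 890): Jetchev 2008 Thm. 1.4 / Cor. 1.5 READ at the ONE Tamagawa carrier — READING binder K1
`JET.JetchevDivisibilityCarrierNe` (p459625; carrier `q ≠ p`) or K3 `JET.JetchevDivisibilityCarrierMult` (p463660; carrier `q = p` split
multiplicative), both `@[conjecture]` typed readings CONSUMED AS HYPOTHESES (nothing about K1 / K3 is asserted here) — + McCallum 1991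
Cor. 5.6 (`hMcU`), GZK (`hGZK`), Kolyvagin / Gross–Zagier bookkeeping (`hKo`, `hrec`, `hD36`, `hlev`): with `w = ord_p c_q` at the carrier
and a Heegner field `K` in which `ord_p [E(K):ℤy_K] ≤ w`, `Ш(E/ℚ)[p] = 0`, and with `ord_p #Ш_an = 0`, Miller's `BSD(E,p)`.
IN THE KERNEL per cell (`decide` / `norm_num` goals of ONE kit application): the literal Cremona model (`Δ ≠ 0`; global minimality by the
factored Kraus criterion `Supersingular.isGloballyMinimal_of_krausCriterion₃_factored` on the COMPLETE factorisation of `|Δ|`); `ρ̄_{E,p}`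
ONTO (Serre 1972: three Prop-19 witnesses at `p ≥ 5` / an irreducible Frobenius + a Frobenius of order `3` at `p = 3`; the `p`-adic tower
inside the door: Serre IV-23 at `p ≥ 5`, the Tate line at a multiplicative `3`, ONE Frobenius witness mod `9` otherwise); at a
multiplicative `3`: `3 ∣ Δ`, `3 ∤ c₄`; the carrier's Tamagawa number from ONE `TamLocal` (split `I_n`) or exact `TamX` (`IV` / `IV*`)
certificate (n1011-p03's bridges `Additive.IntModelTam.localTamagawaNumber_padic_eq_of_intModel_of_tamLocal` / `_of_tamX`) and
`w ≤ ord_p c_q`. DISPLAYED (hypotheses of every record): `hJ` (READING), `hMcU`, `hGZK`, `hKo`, `hrec`, `hD36`, `hlev`; the Heegner datum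
(`K` imaginary quadratic, `d_K ∉ {−3, −4}`, Heegner hypothesis for the level `N`, `P` a Heegner point of infinite order), bucket A: `q ∣ N`;
the INDEX LINE `hv : ord_p [E(K):ℤP] ≤ w` — THIS UNIT's two-engine deep-field datum, quoted per docstring, NOT re-computed here —;
`hr : r_an ≤ 1`; `hs` / `hvs` : `#Ш_an` a `p`-adic unit (Cremona; exact at rank 0).
What a record is worth is the referee's call (EVIDENCE-grade certificate under displayed binders, as every Heegner-index record of the
cell). Cells in this file: `403650et1`@3, `469386u1`@3, `469854z1`@3, `470538e1`@3, `473418l1`@3, `473598e1`@3.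

References: D. Jetchev, Compos. Math. 144 (2008) Thm. 1.4, Cor. 1.5 [Jetchev2008]; W. McCallum, LMS LN 153 (1991) §1, Cor. 5.6
[McCallumLMS1991]; B. H. Gross, LMS LN 153 (1991) Prop. 2.1 [GrossLMS1991]; V. A. Kolyvagin (1990) [KolyvaginEulerSystems1990];
J.-P. Serre, Invent. Math. 15 (1972) §2.4 Prop. 15, §2.8 Prop. 19 [Serre1972]; J.-P. Serre, *Abelian ℓ-adic representations* IV-23
[SerreAbelianLadic1968]; B. H. Gross, D. Zagier, Invent. Math. 84 (1986) [GrossZagier1986]; R. L. Miller, LMS J. Comput. Math. 14 (2011)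
Thm. 4.1, Cor. 4.8, Def. 1.1 [Miller2011LMS]; C. Wuthrich, Doc. Math. 19 (2014) Lemma 20 [Wuthrich2014]; J. H. Silverman, *AEC* (2009)
VII.1, VII.5 [SilvermanAEC2009], *ATAEC* (1994) IV.9.4 [SilvermanATAEC1994]; A. Kraus, Acta Arith. 54 (1989) [Kraus1989]; Cremona's
tables [Cremona2006].
-/

set_option autoImplicit false

noncomputable section

open scoped Classical

open WeierstrassCurve Literature.NumberTheory.EllipticCurves
  Literature.NumberTheory.EllipticCurves.ModularForms
  Literature.NumberTheory.EllipticCurves.Rank1Residual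
  Literature.NumberTheory.EllipticCurves.Rank1Residual.Typed
  Literature.NumberTheory.EllipticCurves.Rank1Residual.X11RankOneCertificates
  Summit.BirchSwinnertonDyer.BirchSwinnertonDyer.Rank1Residual
  Summit.BirchSwinnertonDyer.BirchSwinnertonDyer.Rank1Residual.IntModel
  Summit.BirchSwinnertonDyer.BirchSwinnertonDyer.Rank1Residual.X11RankOne
  Summit.BirchSwinnertonDyer.BirchSwinnertonDyer.Rank2Observatory.Tam
  Summit.BirchSwinnertonDyer.Rank1Residual.JET

namespace Summit.BirchSwinnertonDyer.Rank1Residual.X4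

/-- **`BSD(E,3)` for `403650et1`** (cell `(403650et1, 3)`, class X4, rank 0; JET grammar key `JETA:403650et1@3`, bucket A at `p = 3`, `E` additive
at `3` (door `JET.bsdp_of_jetRowA3F_tam_min`, `3`-adic tower by a Frobenius witness mod `9`)); `N = 403650 = 2·3^3·5^2·13·23`, additive `II*` at
`3`, `r_an = 0`, `#E(ℚ)_tors = 1`, `∏c = 108`, `#Ш_an = 1`, Cremona galrep: no code at this prime (`ρ̄_{E,3}` onto); `|Δ| = ∏` over `[(2, 54), (3,
11), (5, 9), (13, 1), (23, 3)]` (factored Kraus criterion, every disjunct decided). The ONE carrier: carrier `q = 2` (split `I54`, `c_q = 54`, `w =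
ord_3 c_q = 3`; IN THE KERNEL by the `TamLocal` certificate `⟨2, 1, 1, 0, 0, 0, 0, 54, 0, 0, 54⟩`); READING binder `hJ` = K1
`JetchevDivisibilityCarrierNe`; displayed index line `hv : ord_3 [E(K):ℤP] ≤ 3`. Serre Prop-15 witnesses mod `3`: `(ℓ, #Ẽ(𝔽_ℓ))` = `(11, 16)` (`X² −
aX + ℓ` root-free over `𝔽₃`), `(19, 24)` (`ℓ ≡ 1`, `a ≡ 2 (mod 3)`, `9 ∤ #Ẽ`); `3`-adic tower witness `(ℓ₉, #Ẽ) = (41, 45)` (`ℓ₉ ≡ 5 (mod 9)`, `a_ℓ₉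
≡ 6 (mod 9)`). Kurihara lane note of record: «additive p, irreducible». State of record (referee A ROUND 983,
`scratchA_A_state_after_x4gh_add3_onA2R977_fold.pkl`): class `residue`, 1 open cell(s), register empty. Other engine-1 fields tried (`D`: `m`
(`ord_3 m`)): none. THIS UNIT'S DATUM (displayed, NOT re-computed here): DEEP FIELD `K = ℚ(√-7439)` (`7439` = 43·173): rank-one twist `F = E^D`
(`N_F = 22337474731650`), point `x` on `F` by ellrank1 (saturated at the primes `< 100`), **`m = [E(K):ℤy_K] = 1728`, `ord_3 m = 3`** (`ρ = m²/4`,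
`L(E,1) = 1.6817440798`, `L'(F,1) = 26.549137513`, `ĥ(x) = 35.287851364`) — engine 1 j293870 = engine 2 j294269: `m = 1728` EQUAL
(FAIL:p2_not_div_N, dev ≤ 1.1e-13); twist `E^D` (j294272): `N = 22337474731650`, `#tors·∏c·#Ш_an = 1·864·16`, `ord_3 #Ш_an(E^D) = 0`, `ord_3 ∏c(E^D)
= 3` (BSD-consistent). CONDITIONAL on every binder; per cell; nothing booked by this file.
[cite: Jetchev2008, Thm. 1.4 and Cor. 1.5 (p. 812)] [cite: McCallumLMS1991, Cor. 5.6] [cite: Serre1972, §2.4 Prop. 15, §2.8 Prop. 19] [cite: Cremona2006, Table 1 (label 403650et1)] -/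
theorem bsdpJD_403650et1_3
    (hJ : JetchevDivisibilityCarrierNe)
    (hMcU : McCallum1991_padicValNat_card_sha_primary_add_le_of_globalDivisibility)
    (hGZK : rank_eq_analyticRank_of_analyticRank_le_one)
    (hKo : ∀ (N : ℕ) [NeZero N] (W : WeierstrassCurve ℚ) (K : Type) [Field K] [NumberField K], kolyvagin N W K)
    (hrec : ∀ (N : ℕ) [NeZero N] (W : WeierstrassCurve ℚ) (K : Type) [Field K] [NumberField K],
      heegnerPointOfConductor_one_galoisConj N W K)
    (hD36 : ∀ (N : ℕ) [NeZero N] (W : WeierstrassCurve ℚ) (K : Type) [Field K] [NumberField K],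
      phi_heegnerTau_mem_singularModuliField N W K)
    (hlev : ∀ {N : ℕ} [NeZero N], IsNewformOf.level_eq_conductorNorm (N := N))
    (W : WeierstrassCurve ℚ) (hW : W = ⟨1, -1, 1, -66400125680, 6756747119396947⟩)
    {N : ℕ} [NeZero N] {K : Type} [Field K] [NumberField K] (hK : IsImaginaryQuadratic K)
    (hD3 : NumberField.discr K ≠ -3) (hD4 : NumberField.discr K ≠ -4)
    (hH : SatisfiesHeegnerHypothesis N K) {P : (W.baseChange K).toAffine.Point}
    (hP : IsHeegnerPoint N W K P) (hnt : ¬ IsOfFinAddOrder P) (hqN : 2 ∣ N)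
    (hv : padicValNat 3 (AddSubgroup.zmultiples P).index ≤ 3)
    (hr : W.analyticRank ≤ 1) {s : ℚ} (hs : shaAn W = (s : ℂ)) (hvs : padicValRat 3 s = 0) : BSDp W 3 :=
  bsdp_of_jetRowA3F_tam_min 1 (-1) 1 (-66400125680) 6756747119396947
    (Supersingular.isGloballyMinimal_of_krausCriterion₃_factored 1 (-1) 1 (-66400125680) 6756747119396947 [(2, 54), (3, 11), (5, 9), (13, 1), (23, 3)] (by decide +kernel)
      (by intro t ht; fin_cases ht <;> norm_num) (by decide +kernel))
    11 19 (by norm_num) (by norm_num) (by decide) (by decide) (by decide) (by decide) (by decide +kernel) (by decide +kernel)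
    (n₁ := 16) (n₂ := 24) (by decide +kernel) (by decide +kernel) (by decide) (by decide) (by decide) (by decide)
    41 (by norm_num) (by decide) (by decide +kernel) (n₉ := 45) (by decide +kernel) (by decide) (by decide)
    2 ⟨2, 1, 1, 0, 0, 0, 0, 54, 0, 0, 54⟩ rfl (by decide +kernel) (c := 54) (by decide +kernel) (w := 3) (by decide +kernel) (by decide)
    hJ hMcU hGZK hKo hrec hD36 hlev W hW hK hD3 hD4 hH hP hnt hqN hv hr hs hvs

/-- **`BSD(E,3)` for `469386u1`** (cell `(469386u1, 3)`, class X4, rank 0; JET grammar key `JETA:469386u1@3`, bucket A at `p = 3`, `E` additive at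
`3` (door `JET.bsdp_of_jetRowA3F_tam_min`, `3`-adic tower by a Frobenius witness mod `9`)); `N = 469386 = 2·3^2·89·293`, additive `III*` at `3`,
`r_an = 0`, `#E(ℚ)_tors = 1`, `∏c = 36`, `#Ш_an = 1`, Cremona galrep: no code at this prime (`ρ̄_{E,3}` onto); `|Δ| = ∏` over `[(2, 9), (3, 9), (89,
4), (293, 1)]` (factored Kraus criterion, every disjunct decided). The ONE carrier: carrier `q = 2` (split `I9`, `c_q = 9`, `w = ord_3 c_q = 2`; IN
THE KERNEL by the `TamLocal` certificate `⟨2, 1, 1, 0, 0, 0, 0, 9, 0, 0, 9⟩`); READING binder `hJ` = K1 `JetchevDivisibilityCarrierNe`; displayed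
index line `hv : ord_3 [E(K):ℤP] ≤ 2`. Serre Prop-15 witnesses mod `3`: `(ℓ, #Ẽ(𝔽_ℓ))` = `(13, 11)` (`X² − aX + ℓ` root-free over `𝔽₃`), `(19, 24)`
(`ℓ ≡ 1`, `a ≡ 2 (mod 3)`, `9 ∤ #Ẽ`); `3`-adic tower witness `(ℓ₉, #Ẽ) = (11, 9)` (`ℓ₉ ≡ 2 (mod 9)`, `a_ℓ₉ ≡ 3 (mod 9)`). Kurihara lane note of
record: «additive p, irreducible». State of record (referee A ROUND 983, `scratchA_A_state_after_x4gh_add3_onA2R977_fold.pkl`): class `residue`, 1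
open cell(s), register empty. Other engine-1 fields tried (`D`: `m` (`ord_3 m`)): `-167`: `m = 72` (`ord = 2`); `-287`: `m = 72` (`ord = 2`);
`-551`: `m = 144` (`ord = 2`); `-935`: `m = 144` (`ord = 2`); `-1727`: `m = 144` (`ord = 2`); `-1919`: `m = 144` (`ord = 2`). THIS UNIT'S DATUM
(displayed, NOT re-computed here): DEEP FIELD `K = ℚ(√-71)` (`71` = prime): rank-one twist `F = E^D` (`N_F = 2366174826`), point `x` on `F` by
ellrank0 (saturated at the primes `< 100`), **`m = [E(K):ℤy_K] = 72`, `ord_3 m = 2`** (`ρ = m²/4`, `L(E,1) = 4.9929489804`, `L'(F,1) =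
5.6922345814`, `ĥ(x) = 4.2156405557`) — engine 1 j293245 = engine 2 j295995: `m = 72` EQUAL (FAIL:p2_not_div_N, dev ≤ 1.5e-14); twist `E^D`
(j293857): `N = 2366174826`, `#tors·∏c·#Ш_an = 1·36·1`, `ord_3 #Ш_an(E^D) = 0`, `ord_3 ∏c(E^D) = 2` (BSD-consistent). CONDITIONAL on every binder;
per cell; nothing booked by this file.
[cite: Jetchev2008, Thm. 1.4 and Cor. 1.5 (p. 812)] [cite: McCallumLMS1991, Cor. 5.6] [cite: Serre1972, §2.4 Prop. 15, §2.8 Prop. 19] [cite: Cremona2006, Table 1 (label 469386u1)] -/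
theorem bsdpJD_469386u1_3
    (hJ : JetchevDivisibilityCarrierNe)
    (hMcU : McCallum1991_padicValNat_card_sha_primary_add_le_of_globalDivisibility)
    (hGZK : rank_eq_analyticRank_of_analyticRank_le_one)
    (hKo : ∀ (N : ℕ) [NeZero N] (W : WeierstrassCurve ℚ) (K : Type) [Field K] [NumberField K], kolyvagin N W K)
    (hrec : ∀ (N : ℕ) [NeZero N] (W : WeierstrassCurve ℚ) (K : Type) [Field K] [NumberField K],
      heegnerPointOfConductor_one_galoisConj N W K)
    (hD36 : ∀ (N : ℕ) [NeZero N] (W : WeierstrassCurve ℚ) (K : Type) [Field K] [NumberField K],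
      phi_heegnerTau_mem_singularModuliField N W K)
    (hlev : ∀ {N : ℕ} [NeZero N], IsNewformOf.level_eq_conductorNorm (N := N))
    (W : WeierstrassCurve ℚ) (hW : W = ⟨1, -1, 1, -1404245, -639803987⟩)
    {N : ℕ} [NeZero N] {K : Type} [Field K] [NumberField K] (hK : IsImaginaryQuadratic K)
    (hD3 : NumberField.discr K ≠ -3) (hD4 : NumberField.discr K ≠ -4)
    (hH : SatisfiesHeegnerHypothesis N K) {P : (W.baseChange K).toAffine.Point}
    (hP : IsHeegnerPoint N W K P) (hnt : ¬ IsOfFinAddOrder P) (hqN : 2 ∣ N)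
    (hv : padicValNat 3 (AddSubgroup.zmultiples P).index ≤ 2)
    (hr : W.analyticRank ≤ 1) {s : ℚ} (hs : shaAn W = (s : ℂ)) (hvs : padicValRat 3 s = 0) : BSDp W 3 :=
  bsdp_of_jetRowA3F_tam_min 1 (-1) 1 (-1404245) (-639803987)
    (Supersingular.isGloballyMinimal_of_krausCriterion₃_factored 1 (-1) 1 (-1404245) (-639803987) [(2, 9), (3, 9), (89, 4), (293, 1)] (by decide +kernel)
      (by intro t ht; fin_cases ht <;> norm_num) (by decide +kernel))
    13 19 (by norm_num) (by norm_num) (by decide) (by decide) (by decide) (by decide) (by decide +kernel) (by decide +kernel)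
    (n₁ := 11) (n₂ := 24) (by decide +kernel) (by decide +kernel) (by decide) (by decide) (by decide) (by decide)
    11 (by norm_num) (by decide) (by decide +kernel) (n₉ := 9) (by decide +kernel) (by decide) (by decide)
    2 ⟨2, 1, 1, 0, 0, 0, 0, 9, 0, 0, 9⟩ rfl (by decide +kernel) (c := 9) (by decide +kernel) (w := 2) (by decide +kernel) (by decide)
    hJ hMcU hGZK hKo hrec hD36 hlev W hW hK hD3 hD4 hH hP hnt hqN hv hr hs hvs

/-- **`BSD(E,3)` for `469854z1`** (cell `(469854z1, 3)`, class X4, rank 0; JET grammar key `JETA:469854z1@3`, bucket A at `p = 3`, `E` additive at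
`3` (door `JET.bsdp_of_jetRowA3F_tam_min`, `3`-adic tower by a Frobenius witness mod `9`)); `N = 469854 = 2·3^3·7·11·113`, additive `II*` at `3`,
`r_an = 0`, `#E(ℚ)_tors = 1`, `∏c = 90`, `#Ш_an = 1`, Cremona galrep: no code at this prime (`ρ̄_{E,3}` onto); `|Δ| = ∏` over `[(2, 45), (3, 11),
(7, 1), (11, 2), (113, 1)]` (factored Kraus criterion, every disjunct decided). The ONE carrier: carrier `q = 2` (split `I45`, `c_q = 45`, `w =
ord_3 c_q = 2`; IN THE KERNEL by the `TamLocal` certificate `⟨2, 1, 1, 0, 0, 0, 0, 45, 0, 0, 45⟩`); READING binder `hJ` = K1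
`JetchevDivisibilityCarrierNe`; displayed index line `hv : ord_3 [E(K):ℤP] ≤ 2`. Serre Prop-15 witnesses mod `3`: `(ℓ, #Ẽ(𝔽_ℓ))` = `(5, 4)` (`X² −
aX + ℓ` root-free over `𝔽₃`), `(13, 12)` (`ℓ ≡ 1`, `a ≡ 2 (mod 3)`, `9 ∤ #Ẽ`); `3`-adic tower witness `(ℓ₉, #Ẽ) = (59, 66)` (`ℓ₉ ≡ 5 (mod 9)`, `a_ℓ₉
≡ 3 (mod 9)`). Kurihara lane note of record: «additive p, irreducible». State of record (referee A ROUND 983,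
`scratchA_A_state_after_x4gh_add3_onA2R977_fold.pkl`): class `residue`, 1 open cell(s), register empty. Other engine-1 fields tried (`D`: `m`
(`ord_3 m`)): `-503`: `m = 180` (`ord = 2`); `-5183`: `m = 360` (`ord = 2`). THIS UNIT'S DATUM (displayed, NOT re-computed here): DEEP FIELD `K =
ℚ(√-215)` (`215` = 5·43): rank-one twist `F = E^D` (`N_F = 21719001150`), point `x` on `F` by ellrank0 (saturated at the primes `< 100`), **`m =
[E(K):ℤy_K] = 360`, `ord_3 m = 2`** (`ρ = m²/4`, `L(E,1) = 6.6726475422`, `L'(F,1) = 15.432869019`, `ĥ(x) = 7.6139366307`) — engine 1 j293243 =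
engine 2 j295997: `m = 360` EQUAL (FAIL:p2_not_div_N, dev ≤ 2.2e-14); twist `E^D` (j293857): `N = 21719001150`, `#tors·∏c·#Ш_an = 1·720·1`, `ord_3
#Ш_an(E^D) = 0`, `ord_3 ∏c(E^D) = 2` (BSD-consistent). CONDITIONAL on every binder; per cell; nothing booked by this file.
[cite: Jetchev2008, Thm. 1.4 and Cor. 1.5 (p. 812)] [cite: McCallumLMS1991, Cor. 5.6] [cite: Serre1972, §2.4 Prop. 15, §2.8 Prop. 19] [cite: Cremona2006, Table 1 (label 469854z1)] -/
theorem bsdpJD_469854z1_3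
    (hJ : JetchevDivisibilityCarrierNe)
    (hMcU : McCallum1991_padicValNat_card_sha_primary_add_le_of_globalDivisibility)
    (hGZK : rank_eq_analyticRank_of_analyticRank_le_one)
    (hKo : ∀ (N : ℕ) [NeZero N] (W : WeierstrassCurve ℚ) (K : Type) [Field K] [NumberField K], kolyvagin N W K)
    (hrec : ∀ (N : ℕ) [NeZero N] (W : WeierstrassCurve ℚ) (K : Type) [Field K] [NumberField K],
      heegnerPointOfConductor_one_galoisConj N W K)
    (hD36 : ∀ (N : ℕ) [NeZero N] (W : WeierstrassCurve ℚ) (K : Type) [Field K] [NumberField K],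
      phi_heegnerTau_mem_singularModuliField N W K)
    (hlev : ∀ {N : ℕ} [NeZero N], IsNewformOf.level_eq_conductorNorm (N := N))
    (W : WeierstrassCurve ℚ) (hW : W = ⟨1, -1, 1, -1972514, 37176229153⟩)
    {N : ℕ} [NeZero N] {K : Type} [Field K] [NumberField K] (hK : IsImaginaryQuadratic K)
    (hD3 : NumberField.discr K ≠ -3) (hD4 : NumberField.discr K ≠ -4)
    (hH : SatisfiesHeegnerHypothesis N K) {P : (W.baseChange K).toAffine.Point}
    (hP : IsHeegnerPoint N W K P) (hnt : ¬ IsOfFinAddOrder P) (hqN : 2 ∣ N)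
    (hv : padicValNat 3 (AddSubgroup.zmultiples P).index ≤ 2)
    (hr : W.analyticRank ≤ 1) {s : ℚ} (hs : shaAn W = (s : ℂ)) (hvs : padicValRat 3 s = 0) : BSDp W 3 :=
  bsdp_of_jetRowA3F_tam_min 1 (-1) 1 (-1972514) 37176229153
    (Supersingular.isGloballyMinimal_of_krausCriterion₃_factored 1 (-1) 1 (-1972514) 37176229153 [(2, 45), (3, 11), (7, 1), (11, 2), (113, 1)] (by decide +kernel)
      (by intro t ht; fin_cases ht <;> norm_num) (by decide +kernel))
    5 13 (by norm_num) (by norm_num) (by decide) (by decide) (by decide) (by decide) (by decide +kernel) (by decide +kernel)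
    (n₁ := 4) (n₂ := 12) (by decide +kernel) (by decide +kernel) (by decide) (by decide) (by decide) (by decide)
    59 (by norm_num) (by decide) (by decide +kernel) (n₉ := 66) (by decide +kernel) (by decide) (by decide)
    2 ⟨2, 1, 1, 0, 0, 0, 0, 45, 0, 0, 45⟩ rfl (by decide +kernel) (c := 45) (by decide +kernel) (w := 2) (by decide +kernel) (by decide)
    hJ hMcU hGZK hKo hrec hD36 hlev W hW hK hD3 hD4 hH hP hnt hqN hv hr hs hvs

/-- **`BSD(E,3)` for `470538e1`** (cell `(470538e1, 3)`, class X4, rank 0; JET grammar key `JETA:470538e1@3`, bucket A at `p = 3`, `E` additive at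
`3` (door `JET.bsdp_of_jetRowA3F_tam_min`, `3`-adic tower by a Frobenius witness mod `9`)); `N = 470538 = 2·3^2·26141`, additive `III*` at `3`,
`r_an = 0`, `#E(ℚ)_tors = 2`, `∏c = 36`, `#Ш_an = 1`, Cremona galrep: no code at this prime (`ρ̄_{E,3}` onto); `|Δ| = ∏` over `[(2, 18), (3, 9),
(26141, 1)]` (factored Kraus criterion, every disjunct decided). The ONE carrier: carrier `q = 2` (split `I18`, `c_q = 18`, `w = ord_3 c_q = 2`; IN
THE KERNEL by the `TamLocal` certificate `⟨2, 1, 1, 0, 0, 0, 0, 18, 0, 0, 18⟩`); READING binder `hJ` = K1 `JetchevDivisibilityCarrierNe`; displayed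
index line `hv : ord_3 [E(K):ℤP] ≤ 2`. Serre Prop-15 witnesses mod `3`: `(ℓ, #Ẽ(𝔽_ℓ))` = `(5, 4)` (`X² − aX + ℓ` root-free over `𝔽₃`), `(7, 6)` (`ℓ
≡ 1`, `a ≡ 2 (mod 3)`, `9 ∤ #Ẽ`); `3`-adic tower witness `(ℓ₉, #Ẽ) = (29, 36)` (`ℓ₉ ≡ 2 (mod 9)`, `a_ℓ₉ ≡ 3 (mod 9)`). Kurihara lane note of record:
«additive p, irreducible». State of record (referee A ROUND 983, `scratchA_A_state_after_x4gh_add3_onA2R977_fold.pkl`): class `residue`, 1 open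
cell(s), register empty. FLAG `opt-code-2` (Cremona optimality code 2; `ρ̄_{E,3}` onto forbids a `3`-isogeny in the class, so `ord_3` of the index
is class-invariant; the reading stands if the optimal curve's Manin constant is prime to `3`). Other engine-1 fields tried (`D`: `m` (`ord_3 m`)):
`-95`: `m = 36` (`ord = 2`); `-119`: `m = 36` (`ord = 2`); `-167`: `m = 18` (`ord = 2`); `-215`: `m = 36` (`ord = 2`); `-263`: `m = 18` (`ord = 2`);
`-287`: `m = 36` (`ord = 2`); `-503`: `m = 18` (`ord = 2`); `-647`: `m = 54` (`ord = 3`); `-695`: `m = 36` (`ord = 2`). THIS UNIT'S DATUM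
(displayed, NOT re-computed here): DEEP FIELD `K = ℚ(√-23)` (`23` = prime): rank-one twist `F = E^D` (`N_F = 248914602`), point `x` on `F` by
ellrank0 (saturated at the primes `< 100`), **`m = [E(K):ℤy_K] = 18`, `ord_3 m = 2`** (`ρ = m²/4`, `L(E,1) = 3.5088360748`, `L'(F,1) =
9.4181380145`, `ĥ(x) = 8.0044232558`) — engine 1 j293243 = engine 2 j295408: `m = 18` EQUAL (FAIL:p2_not_div_N, dev ≤ 1.1e-15); twist `E^D`
(j293857): `N = 248914602`, `#tors·∏c·#Ш_an = 2·72·1`, `ord_3 #Ш_an(E^D) = 0`, `ord_3 ∏c(E^D) = 2` (BSD-consistent). CONDITIONAL on every binder;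
per cell; nothing booked by this file.
[cite: Jetchev2008, Thm. 1.4 and Cor. 1.5 (p. 812)] [cite: McCallumLMS1991, Cor. 5.6] [cite: Serre1972, §2.4 Prop. 15, §2.8 Prop. 19] [cite: Cremona2006, Table 1 (label 470538e1)] -/
theorem bsdpJD_470538e1_3
    (hJ : JetchevDivisibilityCarrierNe)
    (hMcU : McCallum1991_padicValNat_card_sha_primary_add_le_of_globalDivisibility)
    (hGZK : rank_eq_analyticRank_of_analyticRank_le_one)
    (hKo : ∀ (N : ℕ) [NeZero N] (W : WeierstrassCurve ℚ) (K : Type) [Field K] [NumberField K], kolyvagin N W K)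
    (hrec : ∀ (N : ℕ) [NeZero N] (W : WeierstrassCurve ℚ) (K : Type) [Field K] [NumberField K],
      heegnerPointOfConductor_one_galoisConj N W K)
    (hD36 : ∀ (N : ℕ) [NeZero N] (W : WeierstrassCurve ℚ) (K : Type) [Field K] [NumberField K],
      phi_heegnerTau_mem_singularModuliField N W K)
    (hlev : ∀ {N : ℕ} [NeZero N], IsNewformOf.level_eq_conductorNorm (N := N))
    (W : WeierstrassCurve ℚ) (hW : W = ⟨1, -1, 1, 10096, 397171⟩)
    {N : ℕ} [NeZero N] {K : Type} [Field K] [NumberField K] (hK : IsImaginaryQuadratic K)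
    (hD3 : NumberField.discr K ≠ -3) (hD4 : NumberField.discr K ≠ -4)
    (hH : SatisfiesHeegnerHypothesis N K) {P : (W.baseChange K).toAffine.Point}
    (hP : IsHeegnerPoint N W K P) (hnt : ¬ IsOfFinAddOrder P) (hqN : 2 ∣ N)
    (hv : padicValNat 3 (AddSubgroup.zmultiples P).index ≤ 2)
    (hr : W.analyticRank ≤ 1) {s : ℚ} (hs : shaAn W = (s : ℂ)) (hvs : padicValRat 3 s = 0) : BSDp W 3 :=
  bsdp_of_jetRowA3F_tam_min 1 (-1) 1 10096 397171
    (Supersingular.isGloballyMinimal_of_krausCriterion₃_factored 1 (-1) 1 10096 397171 [(2, 18), (3, 9), (26141, 1)] (by decide +kernel)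
      (by intro t ht; fin_cases ht <;> norm_num) (by decide +kernel))
    5 7 (by norm_num) (by norm_num) (by decide) (by decide) (by decide) (by decide) (by decide +kernel) (by decide +kernel)
    (n₁ := 4) (n₂ := 6) (by decide +kernel) (by decide +kernel) (by decide) (by decide) (by decide) (by decide)
    29 (by norm_num) (by decide) (by decide +kernel) (n₉ := 36) (by decide +kernel) (by decide) (by decide)
    2 ⟨2, 1, 1, 0, 0, 0, 0, 18, 0, 0, 18⟩ rfl (by decide +kernel) (c := 18) (by decide +kernel) (w := 2) (by decide +kernel) (by decide)
    hJ hMcU hGZK hKo hrec hD36 hlev W hW hK hD3 hD4 hH hP hnt hqN hv hr hs hvs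

/-- **`BSD(E,3)` for `473418l1`** (cell `(473418l1, 3)`, class X4, rank 0; JET grammar key `JETA:473418l1@3`, bucket A at `p = 3`, `E` additive at
`3` (door `JET.bsdp_of_jetRowA3F_tam_min`, `3`-adic tower by a Frobenius witness mod `9`)); `N = 473418 = 2·3^3·11·797`, additive `II*` at `3`,
`r_an = 0`, `#E(ℚ)_tors = 1`, `∏c = 9`, `#Ш_an = 1`, Cremona galrep: no code at this prime (`ρ̄_{E,3}` onto); `|Δ| = ∏` over `[(2, 9), (3, 11), (11,
1), (797, 1)]` (factored Kraus criterion, every disjunct decided). The ONE carrier: carrier `q = 2` (split `I9`, `c_q = 9`, `w = ord_3 c_q = 2`; IN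
THE KERNEL by the `TamLocal` certificate `⟨2, 1, 1, 0, 0, 0, 0, 9, 0, 0, 9⟩`); READING binder `hJ` = K1 `JetchevDivisibilityCarrierNe`; displayed
index line `hv : ord_3 [E(K):ℤP] ≤ 2`. Serre Prop-15 witnesses mod `3`: `(ℓ, #Ẽ(𝔽_ℓ))` = `(5, 10)` (`X² − aX + ℓ` root-free over `𝔽₃`), `(13, 12)`
(`ℓ ≡ 1`, `a ≡ 2 (mod 3)`, `9 ∤ #Ẽ`); `3`-adic tower witness `(ℓ₉, #Ẽ) = (47, 42)` (`ℓ₉ ≡ 2 (mod 9)`, `a_ℓ₉ ≡ 6 (mod 9)`). Kurihara lane note of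
record: «additive p, irreducible». State of record (referee A ROUND 983, `scratchA_A_state_after_x4gh_add3_onA2R977_fold.pkl`): class `residue`, 1
open cell(s), register empty. Other engine-1 fields tried (`D`: `m` (`ord_3 m`)): `-239`: `m = 18` (`ord = 2`); `-359`: `m = 18` (`ord = 2`);
`-431`: `m = 18` (`ord = 2`); `-503`: `m = 54` (`ord = 3`); `-695`: `m = 36` (`ord = 2`); `-791`: `m = 72` (`ord = 2`); `-1055`: `m = 18` (`ord =
2`); `-1319`: `m = 18` (`ord = 2`); `-1415`: `m = 18` (`ord = 2`). THIS UNIT'S DATUM (displayed, NOT re-computed here): DEEP FIELD `K = ℚ(√-95)`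
(`95` = 5·19): rank-one twist `F = E^D` (`N_F = 4272597450`), point `x` on `F` by ellrank0 (saturated at the primes `< 100`), **`m = [E(K):ℤy_K] =
18`, `ord_3 m = 2`** (`ρ = m²/4`, `L(E,1) = 2.6172401869`, `L'(F,1) = 64.914016295`, `ĥ(x) = 40.073792571`) — engine 1 j293245 = engine 2 j293855:
`m = 18` EQUAL (FAIL:p2_not_div_N, dev ≤ 1.1e-14); twist `E^D` (j293857): `N = 4272597450`, `#tors·∏c·#Ш_an = 1·18·1`, `ord_3 #Ш_an(E^D) = 0`,
`ord_3 ∏c(E^D) = 2` (BSD-consistent). CONDITIONAL on every binder; per cell; nothing booked by this file.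
[cite: Jetchev2008, Thm. 1.4 and Cor. 1.5 (p. 812)] [cite: McCallumLMS1991, Cor. 5.6] [cite: Serre1972, §2.4 Prop. 15, §2.8 Prop. 19] [cite: Cremona2006, Table 1 (label 473418l1)] -/
theorem bsdpJD_473418l1_3
    (hJ : JetchevDivisibilityCarrierNe)
    (hMcU : McCallum1991_padicValNat_card_sha_primary_add_le_of_globalDivisibility)
    (hGZK : rank_eq_analyticRank_of_analyticRank_le_one)
    (hKo : ∀ (N : ℕ) [NeZero N] (W : WeierstrassCurve ℚ) (K : Type) [Field K] [NumberField K], kolyvagin N W K)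
    (hrec : ∀ (N : ℕ) [NeZero N] (W : WeierstrassCurve ℚ) (K : Type) [Field K] [NumberField K],
      heegnerPointOfConductor_one_galoisConj N W K)
    (hD36 : ∀ (N : ℕ) [NeZero N] (W : WeierstrassCurve ℚ) (K : Type) [Field K] [NumberField K],
      phi_heegnerTau_mem_singularModuliField N W K)
    (hlev : ∀ {N : ℕ} [NeZero N], IsNewformOf.level_eq_conductorNorm (N := N))
    (W : WeierstrassCurve ℚ) (hW : W = ⟨1, -1, 1, -4457, -121175⟩)
    {N : ℕ} [NeZero N] {K : Type} [Field K] [NumberField K] (hK : IsImaginaryQuadratic K)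
    (hD3 : NumberField.discr K ≠ -3) (hD4 : NumberField.discr K ≠ -4)
    (hH : SatisfiesHeegnerHypothesis N K) {P : (W.baseChange K).toAffine.Point}
    (hP : IsHeegnerPoint N W K P) (hnt : ¬ IsOfFinAddOrder P) (hqN : 2 ∣ N)
    (hv : padicValNat 3 (AddSubgroup.zmultiples P).index ≤ 2)
    (hr : W.analyticRank ≤ 1) {s : ℚ} (hs : shaAn W = (s : ℂ)) (hvs : padicValRat 3 s = 0) : BSDp W 3 :=
  bsdp_of_jetRowA3F_tam_min 1 (-1) 1 (-4457) (-121175)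
    (Supersingular.isGloballyMinimal_of_krausCriterion₃_factored 1 (-1) 1 (-4457) (-121175) [(2, 9), (3, 11), (11, 1), (797, 1)] (by decide +kernel)
      (by intro t ht; fin_cases ht <;> norm_num) (by decide +kernel))
    5 13 (by norm_num) (by norm_num) (by decide) (by decide) (by decide) (by decide) (by decide +kernel) (by decide +kernel)
    (n₁ := 10) (n₂ := 12) (by decide +kernel) (by decide +kernel) (by decide) (by decide) (by decide) (by decide)
    47 (by norm_num) (by decide) (by decide +kernel) (n₉ := 42) (by decide +kernel) (by decide) (by decide)
    2 ⟨2, 1, 1, 0, 0, 0, 0, 9, 0, 0, 9⟩ rfl (by decide +kernel) (c := 9) (by decide +kernel) (w := 2) (by decide +kernel) (by decide)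
    hJ hMcU hGZK hKo hrec hD36 hlev W hW hK hD3 hD4 hH hP hnt hqN hv hr hs hvs

/-- **`BSD(E,3)` for `473598e1`** (cell `(473598e1, 3)`, class X4, rank 0; JET grammar key `JETA:473598e1@3`, bucket A at `p = 3`, `E` additive at
`3` (door `JET.bsdp_of_jetRowA3F_tam_min`, `3`-adic tower by a Frobenius witness mod `9`)); `N = 473598 = 2·3^2·83·317`, additive `III` at `3`,
`r_an = 0`, `#E(ℚ)_tors = 1`, `∏c = 18`, `#Ш_an = 1`, Cremona galrep: no code at this prime (`ρ̄_{E,3}` onto); `|Δ| = ∏` over `[(2, 9), (3, 3), (83,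
1), (317, 1)]` (factored Kraus criterion, every disjunct decided). The ONE carrier: carrier `q = 2` (split `I9`, `c_q = 9`, `w = ord_3 c_q = 2`; IN
THE KERNEL by the `TamLocal` certificate `⟨2, 1, 1, 0, 0, 0, 0, 9, 0, 0, 9⟩`); READING binder `hJ` = K1 `JetchevDivisibilityCarrierNe`; displayed
index line `hv : ord_3 [E(K):ℤP] ≤ 2`. Serre Prop-15 witnesses mod `3`: `(ℓ, #Ẽ(𝔽_ℓ))` = `(13, 14)` (`X² − aX + ℓ` root-free over `𝔽₃`), `(7, 6)`
(`ℓ ≡ 1`, `a ≡ 2 (mod 3)`, `9 ∤ #Ẽ`); `3`-adic tower witness `(ℓ₉, #Ẽ) = (5, 3)` (`ℓ₉ ≡ 5 (mod 9)`, `a_ℓ₉ ≡ 3 (mod 9)`). Kurihara lane note of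
record: «additive p, irreducible». State of record (referee A ROUND 983, `scratchA_A_state_after_x4gh_add3_onA2R977_fold.pkl`): class `residue`, 1
open cell(s), register empty. Other engine-1 fields tried (`D`: `m` (`ord_3 m`)): `-311`: `m = 36` (`ord = 2`); `-503`: `m = 36` (`ord = 2`);
`-551`: `m = 36` (`ord = 2`); `-623`: `m = 72` (`ord = 2`); `-719`: `m = 36` (`ord = 2`); `-887`: `m = 36` (`ord = 2`); `-935`: `m = 36` (`ord =
2`); `-1103`: `m = 36` (`ord = 2`); `-1367`: `m = 36` (`ord = 2`); `-1679`: `m = 72` (`ord = 2`); `-1727`: `m = 36` (`ord = 2`); `-1823`: `m = 36`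
(`ord = 2`); `-1871`: `m = 36` (`ord = 2`). THIS UNIT'S DATUM (displayed, NOT re-computed here): DEEP FIELD `K = ℚ(√-263)` (`263` = prime): rank-one
twist `F = E^D` (`N_F = 32758300062`), point `x` on `F` by ellrank0 (saturated at the primes `< 100`), **`m = [E(K):ℤy_K] = 36`, `ord_3 m = 2`** (`ρ
= m²/4`, `L(E,1) = 11.671470589`, `L'(F,1) = 14.565055670`, `ĥ(x) = 4.2083728813`) — engine 1 j293243 = engine 2 j293855: `m = 36` EQUAL
(FAIL:p2_not_div_N, dev ≤ 3.3e-14); twist `E^D` (j293857): `N = 32758300062`, `#tors·∏c·#Ш_an = 1·36·1`, `ord_3 #Ш_an(E^D) = 0`, `ord_3 ∏c(E^D) = 2`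
(BSD-consistent). CONDITIONAL on every binder; per cell; nothing booked by this file.
[cite: Jetchev2008, Thm. 1.4 and Cor. 1.5 (p. 812)] [cite: McCallumLMS1991, Cor. 5.6] [cite: Serre1972, §2.4 Prop. 15, §2.8 Prop. 19] [cite: Cremona2006, Table 1 (label 473598e1)] -/
theorem bsdpJD_473598e1_3
    (hJ : JetchevDivisibilityCarrierNe)
    (hMcU : McCallum1991_padicValNat_card_sha_primary_add_le_of_globalDivisibility)
    (hGZK : rank_eq_analyticRank_of_analyticRank_le_one)
    (hKo : ∀ (N : ℕ) [NeZero N] (W : WeierstrassCurve ℚ) (K : Type) [Field K] [NumberField K], kolyvagin N W K)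
    (hrec : ∀ (N : ℕ) [NeZero N] (W : WeierstrassCurve ℚ) (K : Type) [Field K] [NumberField K],
      heegnerPointOfConductor_one_galoisConj N W K)
    (hD36 : ∀ (N : ℕ) [NeZero N] (W : WeierstrassCurve ℚ) (K : Type) [Field K] [NumberField K],
      phi_heegnerTau_mem_singularModuliField N W K)
    (hlev : ∀ {N : ℕ} [NeZero N], IsNewformOf.level_eq_conductorNorm (N := N))
    (W : WeierstrassCurve ℚ) (hW : W = ⟨1, -1, 1, -161, -1167⟩)
    {N : ℕ} [NeZero N] {K : Type} [Field K] [NumberField K] (hK : IsImaginaryQuadratic K)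
    (hD3 : NumberField.discr K ≠ -3) (hD4 : NumberField.discr K ≠ -4)
    (hH : SatisfiesHeegnerHypothesis N K) {P : (W.baseChange K).toAffine.Point}
    (hP : IsHeegnerPoint N W K P) (hnt : ¬ IsOfFinAddOrder P) (hqN : 2 ∣ N)
    (hv : padicValNat 3 (AddSubgroup.zmultiples P).index ≤ 2)
    (hr : W.analyticRank ≤ 1) {s : ℚ} (hs : shaAn W = (s : ℂ)) (hvs : padicValRat 3 s = 0) : BSDp W 3 :=
  bsdp_of_jetRowA3F_tam_min 1 (-1) 1 (-161) (-1167)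
    (Supersingular.isGloballyMinimal_of_krausCriterion₃_factored 1 (-1) 1 (-161) (-1167) [(2, 9), (3, 3), (83, 1), (317, 1)] (by decide +kernel)
      (by intro t ht; fin_cases ht <;> norm_num) (by decide +kernel))
    13 7 (by norm_num) (by norm_num) (by decide) (by decide) (by decide) (by decide) (by decide +kernel) (by decide +kernel)
    (n₁ := 14) (n₂ := 6) (by decide +kernel) (by decide +kernel) (by decide) (by decide) (by decide) (by decide)
    5 (by norm_num) (by decide) (by decide +kernel) (n₉ := 3) (by decide +kernel) (by decide) (by decide)
    2 ⟨2, 1, 1, 0, 0, 0, 0, 9, 0, 0, 9⟩ rfl (by decide +kernel) (c := 9) (by decide +kernel) (w := 2) (by decide +kernel) (by decide)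
    hJ hMcU hGZK hKo hrec hD36 hlev W hW hK hD3 hD4 hH hP hnt hqN hv hr hs hvs

end Summit.BirchSwinnertonDyer.Rank1Residual.X4

end
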